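import Literature.Probability.LatticeModels.LoopO1
import Literature.Probability.LatticeModels.ModifiedSimonInequality
import Literature.Probability.LatticeModels.IsingThermodynamics
import Summits.CriticalPhenomena.Ising3DConformalLimit.Theorems.FKParityRobustnessDefs
import Summits.CriticalPhenomena.Ising3DConformalLimit.Theorems.FKParityRobustnessDepletionBoundHTE
import HarnessLib

/-!
# Crux IndependentStrandsJoin (stmt-CriticalPhenomena-14625) — the union shadow gives the crux (glue)

Route `FKParityRobustness`, sub-problem `Ising3DConformalLimit`; registered stub `stub_shadowGivesCrux` of the
line `union-shadow-exact` (skeleton `Cruxes/IndependentStrandsJoin/Lines/union_shadow_exact.lean`, stub 2): from the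
union-shadow IDENTITY (stub 1, landed as `Theorems.stub_unionShadowIdentity`) and a uniform expected-shadow bound
`UnionShadowDeficit` (constant `c`) follows the body of the route decl `IndependentStrandsJoin` with the SAME
constant `c` and the same `N₀(l)`.  One page of algebra in the box `Λ_N`, `G = (zdGraph 3).comap Subtype.val`,
`β = β_c(3)`, `t = tanh β ≥ 0`:  `Z^{01}·Z^{23} = jointSum + avoidSum` (split the indicator),
`avoidSum = [right-hand side of the identity] ≤ (1 - c)·Z^{23}·Z^∅·⟨σ_{a₀}σ_{a₁}⟩_Λ = (1 - c)·Z^{23}·Z^{01}`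
(high-temperature expansion `⟨σ_{a₀}σ_{a₁}⟩^free_Λ = Z^{01}/Z^∅`, `isingCorr_free_eq_hteSum_div` +
`DepletionBound.loopO1PartitionFunction_eq_hteSum`, `Z^∅ > 0`), hence `jointSum ≥ c·Z^{01}·Z^{23}`; `a = l·tetra` is
injective for `l ≥ 1` (`tetra_injective`).  All three statements are INLINED (the file imports no `Theses` module).

References: M. Aizenman, H. Duminil-Copin, Ann. of Math. 194 (2021), App. A [AizenmanDuminilCopinAnnals2021];
H. Duminil-Copin, lectures on the Ising and Potts models, §2.2.1 [DuminilCopinECM2018].  Theorem-only file.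
-/

noncomputable section

open Finset SimpleGraph
open Literature.Probability.LatticeModels
open Summit.CriticalPhenomena.Ising3DConformalLimit.Cruxes.ParityRobustMerging.PlaquetteXorSurgery
  (tetra tetra_injective tanh_criticalBeta_nonneg)

namespace Summit.CriticalPhenomena.Ising3DConformalLimit.Theorems

open scoped Classical BigOperators

/-- **Registered stub `stub_shadowGivesCrux` of the line `union-shadow-exact`** (crux stmt-CriticalPhenomena-14625):
the union-shadow identity and a uniform expected-shadow bound (constant `c`) give the crux body with the same
constant. -/
theorem stub_shadowGivesCrux :
    (∀ (V : Type) [Fintype V] [DecidableEq V] (G : SimpleGraph V) [DecidableRel G.Adj] (β : ℝ),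
      0 ≤ β → ∀ a : Fin 4 → V, Function.Injective a →
      (∑ F₁ ∈ tJoins G Set.univ {a 0, a 1}, ∑ F₂ ∈ tJoins G Set.univ {a 2, a 3},
          if (SimpleGraph.fromEdgeSet ((↑F₁ : Set (Sym2 V)) ∪ ↑F₂)).Reachable (a 0) (a 2) then (0 : ℝ)
          else Real.tanh β ^ (F₁.card + F₂.card))
        =
      ∑ F₂ ∈ tJoins G Set.univ {a 2, a 3}, ∑ F₀ ∈ tJoins G Set.univ (∅ : Finset V),
          if ¬ (SimpleGraph.fromEdgeSet ((↑F₂ : Set (Sym2 V)) ∪ ↑F₀)).Reachable (a 2) (a 0) ∧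
             ¬ (SimpleGraph.fromEdgeSet ((↑F₂ : Set (Sym2 V)) ∪ ↑F₀)).Reachable (a 2) (a 1)
          then Real.tanh β ^ (F₂.card + F₀.card) *
               isingCorr G (Finset.univ.filter (fun v : V =>
                 ¬ (SimpleGraph.fromEdgeSet ((↑F₂ : Set (Sym2 V)) ∪ ↑F₀)).Reachable (a 2) v)) β 0 .free {a 0, a 1}
          else 0) →
    (∃ c : ℝ, 0 < c ∧ ∀ l : ℕ, 1 ≤ l → ∃ N₀ : ℕ, ∀ N : ℕ, N₀ ≤ N → ∀ a : Fin 4 → ↥(box 3 N),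
      (∀ i, ((a i : Site 3)) = (l : ℤ) •
        (![![-1, -1, -1], ![1, 1, -1], ![1, -1, 1], ![-1, 1, 1]] : Fin 4 → Site 3) i) →
      (∑ F₂ ∈ tJoins ((zdGraph 3).comap (Subtype.val : ↥(box 3 N) → Site 3)) Set.univ {a 2, a 3},
        ∑ F₀ ∈ tJoins ((zdGraph 3).comap (Subtype.val : ↥(box 3 N) → Site 3)) Set.univ (∅ : Finset ↥(box 3 N)),
          if ¬ (SimpleGraph.fromEdgeSet ((↑F₂ : Set (Sym2 ↥(box 3 N))) ∪ ↑F₀)).Reachable (a 2) (a 0) ∧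
             ¬ (SimpleGraph.fromEdgeSet ((↑F₂ : Set (Sym2 ↥(box 3 N))) ∪ ↑F₀)).Reachable (a 2) (a 1)
          then Real.tanh (criticalBeta 3) ^ (F₂.card + F₀.card) *
               isingCorr ((zdGraph 3).comap (Subtype.val : ↥(box 3 N) → Site 3))
                 (Finset.univ.filter (fun v : ↥(box 3 N) =>
                   ¬ (SimpleGraph.fromEdgeSet ((↑F₂ : Set (Sym2 ↥(box 3 N))) ∪ ↑F₀)).Reachable (a 2) v))
                 (criticalBeta 3) 0 .free {a 0, a 1}
          else 0)
        ≤ (1 - c) * (loopO1PartitionFunction ((zdGraph 3).comap (Subtype.val : ↥(box 3 N) → Site 3))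
                (Real.tanh (criticalBeta 3)) {a 2, a 3} *
              loopO1PartitionFunction ((zdGraph 3).comap (Subtype.val : ↥(box 3 N) → Site 3))
                (Real.tanh (criticalBeta 3)) ∅ *
              isingCorr ((zdGraph 3).comap (Subtype.val : ↥(box 3 N) → Site 3)) Finset.univ
                (criticalBeta 3) 0 .free {a 0, a 1})) →
    (let tetra : Fin 4 → Literature.Probability.LatticeModels.Site 3 := ![![-1, -1, -1], ![1, 1, -1], ![1, -1, 1], ![-1, 1, 1]]; ∃ c : ℝ, 0 < c ∧ ∀ l : ℕ, 1 ≤ l → ∃ N₀ : ℕ, ∀ N : ℕ, N₀ ≤ N → ∀ a : Fin 4 → ↥(Literature.Probability.LatticeModels.box 3 N), (∀ i, ((a i : Literature.Probability.LatticeModels.Site 3)) = (l : ℤ) • tetra i) → (let G := ((Literature.Probability.LatticeModels.zdGraph 3).comap (Subtype.val : ↥(Literature.Probability.LatticeModels.box 3 N) → Literature.Probability.LatticeModels.Site 3)); let t : ℝ := Real.tanh (Literature.Probability.LatticeModels.criticalBeta 3); c * Literature.Probability.LatticeModels.loopO1PartitionFunction G t {a 0, a 1} * Literature.Probability.LatticeModels.loopO1PartitionFunction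 G t {a 2, a 3} ≤ ∑ F₁ ∈ Literature.Probability.LatticeModels.tJoins G Set.univ {a 0, a 1}, ∑ F₂ ∈ Literature.Probability.LatticeModels.tJoins G Set.univ {a 2, a 3}, if (SimpleGraph.fromEdgeSet ((↑F₁ : Set (Sym2 ↥(Literature.Probability.LatticeModels.box 3 N))) ∪ ↑F₂)).Reachable (a 0) (a 2) then t ^ (F₁.card + F₂.card) else 0))  := by
  intro hId hDef
  obtain ⟨c, hc, hD⟩ := hDef
  refine ⟨c, hc, fun l hl => ?_⟩
  obtain ⟨N₀, hN⟩ := hD l hl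
  refine ⟨N₀, fun N hNN a ha => ?_⟩
  have hbox := hN N hNN a ha
  dsimp only at hbox ⊢
  set G : SimpleGraph ↥(box 3 N) := (zdGraph 3).comap (Subtype.val : ↥(box 3 N) → Site 3) with hG
  -- `a` is injective (`l ≥ 1`)
  have hinj : Function.Injective a := tetra_injective hl a (fun i => by rw [ha i]; rfl)
  -- the identity in this box
  have hI := hId (↥(box 3 N)) G (criticalBeta 3) (criticalBeta_nonneg 3) a hinj
  -- notation
  set t : ℝ := Real.tanh (criticalBeta 3) with ht
  have ht0 : 0 ≤ t := tanh_criticalBeta_nonneg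
  set Z0 := loopO1PartitionFunction G t ∅ with hZ0def
  set Z01 := loopO1PartitionFunction G t {a 0, a 1} with hZ01def
  set Z23 := loopO1PartitionFunction G t {a 2, a 3} with hZ23def
  set J := ∑ F₁ ∈ tJoins G Set.univ {a 0, a 1}, ∑ F₂ ∈ tJoins G Set.univ {a 2, a 3},
      if (SimpleGraph.fromEdgeSet ((↑F₁ : Set (Sym2 ↥(box 3 N))) ∪ ↑F₂)).Reachable (a 0) (a 2)
        then t ^ (F₁.card + F₂.card) else (0 : ℝ) with hJ
  set Av := ∑ F₁ ∈ tJoins G Set.univ {a 0, a 1}, ∑ F₂ ∈ tJoins G Set.univ {a 2, a 3},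
      if (SimpleGraph.fromEdgeSet ((↑F₁ : Set (Sym2 ↥(box 3 N))) ∪ ↑F₂)).Reachable (a 0) (a 2)
        then (0 : ℝ) else t ^ (F₁.card + F₂.card) with hAv
  have hZ0 : 0 < Z0 := loopO1PartitionFunction_empty_pos G ht0
  -- high-temperature expansion `⟨σ₀σ₁⟩ = Z01 / Z0`
  have hcorr : isingCorr G Finset.univ (criticalBeta 3) 0 .free {a 0, a 1} = Z01 / Z0 := by
    rw [isingCorr_free_eq_hteSum_div G Finset.univ (criticalBeta 3) (Finset.subset_univ _),
      ← DepletionBound.loopO1PartitionFunction_eq_hteSum, ← DepletionBound.loopO1PartitionFunction_eq_hteSum]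
  -- `Z01 · Z23 = J + Av`
  have hsplit : Z01 * Z23 = J + Av := by
    rw [hZ01def, hZ23def, DepletionBound.loopO1PartitionFunction_eq_hteSum,
      DepletionBound.loopO1PartitionFunction_eq_hteSum, ← DepletionBound.sum_tJoins_pow_eq_hteSum,
      ← DepletionBound.sum_tJoins_pow_eq_hteSum, Finset.sum_mul_sum, hJ, hAv, ← Finset.sum_add_distrib]
    refine Finset.sum_congr rfl fun F₁ _ => ?_
    rw [← Finset.sum_add_distrib]
    refine Finset.sum_congr rfl fun F₂ _ => ?_
    split_ifs
    · rw [pow_add, add_zero]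
    · rw [pow_add, zero_add]
  -- the deficit bound, rewritten through the identity and the HT expansion: `Av ≤ (1 - c) Z23 Z01`
  have hAvle : Av ≤ (1 - c) * (Z23 * Z01) := by
    have h1 : Av = _ := hI
    rw [h1]
    refine hbox.trans (le_of_eq ?_)
    rw [hcorr]
    field_simp
  -- conclude
  have : c * Z01 * Z23 = Z01 * Z23 - (1 - c) * (Z23 * Z01) := by ring
  rw [this, hsplit]
  linarith

end Summit.CriticalPhenomena.Ising3DConformalLimit.Theorems

end
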